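import Literature.IUT.LogVolume.ExplicitEstimatesHeights
import Literature.IUT.LogVolume.ExplicitEstimatesLocalJ
import HarnessLib

/-!
# [ExpEst] §1 "Heights" (Def. 1.7 – Prop. 1.9): the symmetrized toric height of `y² = x(x−1)(x−λ)` and
# its comparison with the Weil height of the `j`-invariant — PROVED

S. Mochizuki, I. Fesenko, Y. Hoshi, A. Minamide, W. Porowski, *Explicit estimates in inter-universal
Teichmüller theory*, Kodai Math. J. **45** (2022) 175–236 — [ExpEst], bib key `MochizukiEtAl2022`. §1, p.
189–192 (pdf p15.l30 – p18.l40 of the cell render `run/shared/lean/pub/abc-iut/plan/repair/lit/renders/MFHMP-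
ExplicitEstimates-Kodai2022-book-anonnd-eeiutp`; journal page = pdf page + 174). CLASSICAL ("[elementary and
essentially well-known]", Introduction p. 180), independent of inter-universal Teichmüller theory: nothing is
claim-tagged; every numbered statement is a `theorem` with a proof. TAKES NO SIDE on [IUTchIII] Cor. 3.12; no
abc claim. Cell abc-iut, seat lit-abc-explicitiut (gen 3). Builds on `ExplicitEstimatesHeights.lean` (Def. 1.1,
Lemma 1.3) and `ExplicitEstimatesLocalJ.lean` (Def. 1.4, Lemmas 1.5–1.6). These are the height comparisons
quoted by the printed proofs of Cor. 5.2 (step (P4)), Thm. 5.3 (Claims 5.3A–C: "Lemma 1.3, (i), (iv);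
Proposition 1.8, (i); Remark 1.10.1") and Thm. 5.4 (Claim 5.4C).

## Rendering

* **Def. 1.7** is typed at the level of the Legendre parameter: for `λ ∈ F \ {0,1}` ("`E` is isomorphic over `Q̄` to
  … `y² = x(x−1)(x−λ)`"), "`h^{𝔖-tor}_□(E) := Σ_{σ ∈ 𝔖₃} h^tor_□(σ·λ)`" is the sum of the toric heights over the
  orbit `A = 𝔖₃·λ = {λ, λ⁻¹, 1−λ, (1−λ)⁻¹, λ(λ−1)⁻¹, (λ−1)λ⁻¹}` (`hStorNon`, `hStorArc`, `hStor`, verbatim), with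
  `j(E) = 2^8(λ²−λ+1)³/(λ²(λ−1)²)` = the tree's `Cor22.jInv λ` [cite: SilvermanAEC2009, Prop. III.1.7(b)]. The
  elliptic curve `E` itself, the existence of a Legendre form over `Q̄` ([Silv1] III.1.7 (a)) and the
  independence of the choice of `λ` (III.1.7 (c)) are not formalised: every statement is about `λ` (declared).
  Heights are computed in the number field `F ∋ λ` (Remark 1.7.1: unaffected by finite extension — not
  formalised; consequently Prop. 1.9's hypothesis "`ℚ(λ)` is mono-complex" is rendered "`F` is mono-complex"
  (`ExpEst.IsMonoComplex F`), which is the case `λ = −a/c ∈ L`, `L` mono-complex, of Theorems 5.3/5.4).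
* Sums "`Σ_{v ∈ 𝕍(F)^non} [F_v:ℚ_{p_v}]·log(…‖·‖_v…)`" of the printed proof are sums over Mathlib's `FinitePlace F`
  of the same quantities in `|·|_v = ‖·‖_v^{[F_v:ℚ_{p_v}]}` (the local factors `J, J_{0∞}, …` are multiplicative in
  `|·|`, so `J(|·|_v) = J(‖·‖_v)^{[F_v:ℚ_p]}` and the logarithms carry the weight); `‖2‖_v^{[F_v:ℚ_2]} = |2|_v`
  and `Σ_{v ∣ 2} [F_v:ℚ_2] = [F:ℚ]` become the product formula `Σ_{v ∤ ∞} log|2|_v = −[F:ℚ]·log 2`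
  (`ExpEst.sum_mult_log_add_finsum_log`).
* Prop. 1.9 (iii) (Northcott) is typed for the fixed mono-complex field `F` (Mathlib
  `NumberField.finite_setOf_logHeight₁_le`): WEAKER than print's "determined up to a finite number of
  possibilities" over all of `Q̄` (which needs Northcott in bounded degree `≤ 2`) — declared.
-/

noncomputable section

open scoped Classical

namespace Literature.IUT.LogVolume

namespace ExpEst

open NumberField Real Cor22

/-! ## 0. Local identities for one absolute value -/

section AbsValue

variable {K : Type*} [Field K] (f : AbsoluteValue K ℝ)

/-- `|j(λ)| = |2|^8·J(λ)` for `j(λ) = 2^8(λ²−λ+1)³/(λ²(λ−1)²)` ("the equality `2^{-8}·J(λ)_v = ‖j(E)‖_v`" /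
"`2^8·J(λ)_v = ‖j(E)‖_v`" of the proof of Prop. 1.8, p. 190–191, with the factor `|2|_v^8` kept explicit).
[cite: MochizukiEtAl2022, Prop 1.8 proof p. 190–191] -/
theorem apply_jInv (t : K) : f (jInv t) = f 2 ^ 8 * J f t := by
  unfold jInv J
  simp only [map_div₀, map_mul, map_pow]
  ring

/-- The three toric local factors of `λ, 1−λ, λ(λ−1)⁻¹` multiply to `J_{0∞}(λ)·J_{1∞}(λ)·J_{01}(λ)` (proof of Prop.
1.8, p. 190: "`h^{𝔖-tor}_□(E) = 2·h^tor_□(λ) + 2·h^tor_□(1−λ) + 2·h^tor_□(λ(λ−1)^{-1})` [cf. Lemma 1.3, (i); the set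
`A` of Lemma 1.6, (i)]" and "`[F:ℚ]·h^{𝔖-tor}_□(E) = Σ_v [F_v:ℚ_{p_v}]·log(J_{0∞}(λ)_v·J_{1∞}(λ)_v·J_{01}(λ)_v)`").
[cite: MochizukiEtAl2022, Prop 1.8 proof p. 190] -/
theorem log_toric_three_eq_log_jProd (t : K) (h0 : t ≠ 0) (h1 : t ≠ 1) :
    Real.log (max (f t) (f t)⁻¹) + Real.log (max (f (1 - t)) (f (1 - t))⁻¹) +
      Real.log (max (f (t / (t - 1))) (f (t / (t - 1)))⁻¹) = Real.log (jProd f t) := by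
  have hx : 0 < f t := f.pos h0
  have hy : 0 < f (t - 1) := f.pos (sub_ne_zero.mpr h1)
  have e1 : f (1 - t) = f (t - 1) := f.map_sub 1 t
  have e2 : max (f (t / (t - 1))) (f (t / (t - 1)))⁻¹ = max (f (t - 1) * (f t)⁻¹) (f t * (f (t - 1))⁻¹) := by
    rw [map_div₀, inv_div, div_eq_mul_inv, div_eq_mul_inv, max_comm]
  rw [e1, e2]
  unfold jProd J0inf J1inf J01
  have p1 : 0 < max (f t) (f t)⁻¹ := lt_max_of_lt_left hx
  have p2 : 0 < max (f (t - 1)) (f (t - 1))⁻¹ := lt_max_of_lt_left hy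
  have p3 : 0 < max (f (t - 1) * (f t)⁻¹) (f t * (f (t - 1))⁻¹) := lt_max_of_lt_left (by positivity)
  rw [Real.log_mul (mul_pos p1 p2).ne' p3.ne', Real.log_mul p1.ne' p2.ne']

/-- `J_{0∞}J_{1∞}J_{01} > 0` (each factor is a `max` of positive reals, `λ ∉ {0,1}`). [cite: MochizukiEtAl2022, Def 1.4 p. 186] -/
theorem jProd_pos (t : K) (h0 : t ≠ 0) (h1 : t ≠ 1) : 0 < jProd f t := by
  have hx : 0 < f t := f.pos h0
  have hy : 0 < f (t - 1) := f.pos (sub_ne_zero.mpr h1)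
  unfold jProd J0inf J1inf J01
  exact mul_pos (mul_pos (lt_max_of_lt_left hx) (lt_max_of_lt_left hy))
    (lt_max_of_lt_left (by positivity))

/-- Off the support: if `|λ| = |λ − 1| = 1` then `J_{0∞}J_{1∞}J_{01} = 1`. [cite: MochizukiEtAl2022, Def 1.4 p. 186] -/
theorem jProd_eq_one_of_apply_eq_one {t : K} (hx : f t = 1) (hy : f (t - 1) = 1) : jProd f t = 1 := by
  unfold jProd J0inf J1inf J01; simp [hx, hy]

/-- Off the support, nonarchimedean case: if `|λ| = |λ − 1| = 1` then `J(λ) ≤ 1` (`|λ(λ−1) + 1| ≤ max{1,1}`).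
[cite: MochizukiEtAl2022, Lemma 1.6 (iv) proof p. 189] -/
theorem J_le_one_of_apply_eq_one (hf : IsNonarchimedean f) {t : K} (hx : f t = 1) (hy : f (t - 1) = 1) :
    J f t ≤ 1 := by
  unfold J
  rw [hx, hy]
  have h : f (t ^ 2 - t + 1) ≤ 1 := by
    have h' := hf (t * (t - 1)) 1
    rw [show t * (t - 1) + 1 = t ^ 2 - t + 1 by ring, map_mul, hx, hy, f.map_one] at h'
    simpa using h'
  have h3 : f (t ^ 2 - t + 1) ^ 3 ≤ 1 := pow_le_one₀ (f.nonneg _) h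
  simpa using h3

/-- Lemma 1.6 (iii) at `ε = 2` with natural-number exponents (`2^{6+2} = 2^8`, `2^{9+2} = 2^{11}`), the instance
used in the proof of Prop. 1.8 (ii) ("we take the "`ε`" of Lemma 1.6, (iii), to be `2`", p. 191).
[cite: MochizukiEtAl2022, Prop 1.8 (ii) proof p. 191] -/
theorem jProd_le_max_and_max_le_jProd_two (t : K) (h0 : t ≠ 0) (h1 : t ≠ 1) :
    jProd f t / 2 ^ 2 ≤ max (2 ^ 8 * J f t) 1 ∧ max (2 ^ 8 * J f t) 1 ≤ 2 ^ 11 * jProd f t := by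
  have h := jProd_le_max_and_max_le_jProd f t h0 h1 (ε := 2) (by norm_num)
  have e8 : (2 : ℝ) ^ ((6 : ℝ) + 2) = 2 ^ 8 := by
    rw [show (6 : ℝ) + 2 = ((8 : ℕ) : ℝ) by norm_num, Real.rpow_natCast]
  have e11 : (2 : ℝ) ^ ((9 : ℝ) + 2) = 2 ^ 11 := by
    rw [show (9 : ℝ) + 2 = ((11 : ℕ) : ℝ) by norm_num, Real.rpow_natCast]
  rw [e8, e11] at h
  exact h

/-- The elementary estimate behind Prop. 1.8 (i) (p. 191): for `0 < u ≤ 1` and `J ≥ 0`,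
`0 ≤ log max{J, 1} − log max{u·J, 1} ≤ −log u` (print: `u = 2^{-8}` at places over `2`, `u = 1` elsewhere).
[cite: MochizukiEtAl2022, Prop 1.8 (i) proof p. 191] -/
theorem log_max_sub_log_max_mul_bounds {u J : ℝ} (hu : 0 < u) (hu1 : u ≤ 1) (hJ : 0 ≤ J) :
    0 ≤ Real.log (max J 1) - Real.log (max 1 (u * J)) ∧
      Real.log (max J 1) - Real.log (max 1 (u * J)) ≤ -Real.log u := by
  have hM1 : 1 ≤ max J 1 := le_max_right _ _
  have hM2 : 1 ≤ max 1 (u * J) := le_max_left _ _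
  constructor
  · have hle : max 1 (u * J) ≤ max J 1 :=
      max_le (le_max_right _ _) ((mul_le_of_le_one_left hJ hu1).trans (le_max_left _ _))
    have := Real.log_le_log (by linarith) hle
    linarith
  · have hle : max J 1 ≤ u⁻¹ * max 1 (u * J) := by
      refine max_le ?_ ?_
      · calc J = u⁻¹ * (u * J) := by field_simp
          _ ≤ u⁻¹ * max 1 (u * J) :=
            mul_le_mul_of_nonneg_left (le_max_right _ _) (inv_nonneg.mpr hu.le)
      · exact one_le_mul_of_one_le_of_one_le (one_le_inv_iff₀.mpr ⟨hu, hu1⟩) hM2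
    have := Real.log_le_log (by linarith) hle
    rw [Real.log_mul (inv_ne_zero hu.ne') (by linarith), Real.log_inv] at this
    linarith

end AbsValue

/-! ## 1. Finite-support bookkeeping (as in `ExplicitEstimatesHeights.lean`) -/

variable {F : Type*} [Field F] [NumberField F]

/-- For `α ≠ 0`, a finite set of finite places containing those with `|α|_w ≠ 1`. [folklore] -/
private theorem exists_finset_places' {α : F} (hα : α ≠ 0) :
    ∃ S : Finset (FinitePlace F), ∀ w : FinitePlace F, w α ≠ 1 → w ∈ S := by
  have hfin : (Function.mulSupport fun w : FinitePlace F => w α).Finite :=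
    FinitePlace.hasFiniteMulSupport hα
  exact ⟨hfin.toFinset, fun w hw => hfin.mem_toFinset.mpr hw⟩

/-- A sum over all finite places of a function vanishing off a finite set `S` is the sum over `S`. [folklore] -/
private theorem finsum_eq_sum_of_eq_zero_off (S : Finset (FinitePlace F)) (g : FinitePlace F → ℝ)
    (hg : ∀ w, w ∉ S → g w = 0) : ∑ᶠ w, g w = ∑ w ∈ S, g w :=
  finsum_eq_sum_of_support_subset g fun w hw => by
    rw [Finset.mem_coe]; by_contra h; exact hw (hg w h)

/-- `[F:ℚ] > 0` as a real number. [folklore] -/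
private theorem finrank_pos'' : (0 : ℝ) < Module.finrank ℚ F := by
  exact_mod_cast Module.finrank_pos

/-- `Σ_{w ∣ ∞} m_w = [F:ℚ]` (Mathlib `InfinitePlace.sum_mult_eq`), as reals. [folklore] -/
private theorem sum_mult_real : ∑ w : InfinitePlace F, (w.mult : ℝ) = Module.finrank ℚ F := by
  exact_mod_cast InfinitePlace.sum_mult_eq (K := F)

omit [NumberField F] in
/-- At an archimedean place `|2|_w = 2`. [folklore] -/
private theorem infinitePlace_two (w : InfinitePlace F) : w (2 : F) = 2 := by
  simpa using InfinitePlace.map_natCast w 2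

/-- **`Σ_{v ∤ ∞} log|2|_v = −[F:ℚ]·log 2`** — the product formula at `x = 2` (print: "for every `v ∈ 𝕍(F)^non` lying
over `2` … `‖2‖_v = 2^{-1}`" weighted by `[F_v:ℚ_2]`, summing to `[F:ℚ]`, p. 191). [cite: MochizukiEtAl2022, Prop 1.8 (i) proof p. 191] -/
theorem finsum_log_two : ∑ᶠ w : FinitePlace F, Real.log (w (2 : F)) = -(Module.finrank ℚ F * Real.log 2) := by
  have hpf := sum_mult_log_add_finsum_log (two_ne_zero : (2 : F) ≠ 0)
  have hinf : ∑ w : InfinitePlace F, (w.mult : ℝ) * Real.log (w (2 : F)) = Module.finrank ℚ F * Real.log 2 := by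
    simp_rw [infinitePlace_two]
    rw [← Finset.sum_mul, sum_mult_real]
  linarith

/-! ## 2. Definition 1.7: the symmetrized toric height (p. 189–190) -/

/-- **[ExpEst] Def. 1.7, nonarchimedean part**: for `E ≅ {y² = x(x−1)(x−λ)}`, "`h^{𝔖-tor}_non(E) := Σ_{σ ∈ 𝔖₃}
h^tor_non(σ·λ)`", the sum over the orbit `𝔖₃·λ = A = {λ, λ⁻¹, 1−λ, (1−λ)⁻¹, λ(λ−1)⁻¹, (λ−1)λ⁻¹}` (Lemma 1.6 (i)),
as a function of the Legendre parameter `λ ∈ F \ {0,1}`. [cite: MochizukiEtAl2022, Def 1.7 p. 189–190] -/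
def hStorNon (t : F) : ℝ :=
  hTorNon t + hTorNon t⁻¹ + hTorNon (1 - t) + hTorNon (1 - t)⁻¹ +
    hTorNon (t / (t - 1)) + hTorNon ((t - 1) / t)

/-- **[ExpEst] Def. 1.7, archimedean part**: "`h^{𝔖-tor}_arc(E) := Σ_{σ ∈ 𝔖₃} h^tor_arc(σ·λ)`".
[cite: MochizukiEtAl2022, Def 1.7 p. 189–190] -/
def hStorArc (t : F) : ℝ :=
  hTorArc t + hTorArc t⁻¹ + hTorArc (1 - t) + hTorArc (1 - t)⁻¹ +
    hTorArc (t / (t - 1)) + hTorArc ((t - 1) / t)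

/-- **[ExpEst] Def. 1.7**: "`h^{𝔖-tor}(E) := h^{𝔖-tor}_non(E) + h^{𝔖-tor}_arc(E)` … the symmetrized toric height of
`E`" (also `h^{𝔖-tor}_⊙(E)`). [cite: MochizukiEtAl2022, Def 1.7 p. 189–190] -/
def hStor (t : F) : ℝ := hStorNon t + hStorArc t

/-- The display of the proof of Prop. 1.8 (p. 190): "`h^{𝔖-tor}_non(E) = 2·h^tor_non(λ) + 2·h^tor_non(1−λ) +
2·h^tor_non(λ·(λ−1)^{-1})` [cf. Lemma 1.3, (i); the set `A` of Lemma 1.6, (i)]".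
[cite: MochizukiEtAl2022, Prop 1.8 proof p. 190] -/
theorem hStorNon_eq (t : F) :
    hStorNon t = 2 * (hTorNon t + hTorNon (1 - t) + hTorNon (t / (t - 1))) := by
  unfold hStorNon
  rw [hTorNon_inv, hTorNon_inv, show (t - 1) / t = (t / (t - 1))⁻¹ from (inv_div t (t - 1)).symm,
    hTorNon_inv]
  ring

/-- The display of the proof of Prop. 1.8 (p. 190), archimedean part: "`h^{𝔖-tor}_arc(E) = 2·h^tor_arc(λ) +
2·h^tor_arc(1−λ) + 2·h^tor_arc(λ·(λ−1)^{-1})`". [cite: MochizukiEtAl2022, Prop 1.8 proof p. 190] -/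
theorem hStorArc_eq (t : F) :
    hStorArc t = 2 * (hTorArc t + hTorArc (1 - t) + hTorArc (t / (t - 1))) := by
  unfold hStorArc
  rw [hTorArc_inv, hTorArc_inv, show (t - 1) / t = (t / (t - 1))⁻¹ from (inv_div t (t - 1)).symm,
    hTorArc_inv]
  ring

/-- **[ExpEst] Remark 1.7.2**, `□ = non`: "`h^{𝔖-tor}_□(E) = Σ_{σ ∈ 𝔖₃} h_□(σ·λ)`" (from Lemma 1.3 (i)), `λ ∉ {0,1}`.
[cite: MochizukiEtAl2022, Remark 1.7.2 p. 190] -/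
theorem hStorNon_eq_sum_hNon (t : F) (h0 : t ≠ 0) (h1 : t ≠ 1) :
    hStorNon t = hNon t + hNon t⁻¹ + hNon (1 - t) + hNon (1 - t)⁻¹ +
      hNon (t / (t - 1)) + hNon ((t - 1) / t) := by
  have ht1 : t - 1 ≠ 0 := sub_ne_zero.mpr h1
  have h1t : (1 : F) - t ≠ 0 := sub_ne_zero.mpr (Ne.symm h1)
  rw [hStorNon_eq, hTorNon_eq_half t h0, hTorNon_eq_half (1 - t) h1t,
    hTorNon_eq_half (t / (t - 1)) (div_ne_zero h0 ht1), inv_div]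
  ring

/-- **[ExpEst] Remark 1.7.2**, `□ = arc`. [cite: MochizukiEtAl2022, Remark 1.7.2 p. 190] -/
theorem hStorArc_eq_sum_hArc (t : F) (h0 : t ≠ 0) (h1 : t ≠ 1) :
    hStorArc t = hArc t + hArc t⁻¹ + hArc (1 - t) + hArc (1 - t)⁻¹ +
      hArc (t / (t - 1)) + hArc ((t - 1) / t) := by
  have ht1 : t - 1 ≠ 0 := sub_ne_zero.mpr h1
  have h1t : (1 : F) - t ≠ 0 := sub_ne_zero.mpr (Ne.symm h1)
  rw [hStorArc_eq, hTorArc_eq_half t h0, hTorArc_eq_half (1 - t) h1t,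
    hTorArc_eq_half (t / (t - 1)) (div_ne_zero h0 ht1), inv_div]
  ring

/-! ## 3. Proposition 1.8 (Comparison between `h^{𝔖-tor}_□(E)` and `h_□(j(E))`), p. 190–191 -/

/-- `[F:ℚ]·h^{𝔖-tor}_non(E) = Σ_{v ∤ ∞} log(J_{0∞}(λ)_v·J_{1∞}(λ)_v·J_{01}(λ)_v)` as a finite sum over any finite set
of places containing those where `|λ|_v ≠ 1` or `|λ−1|_v ≠ 1` (proof of Prop. 1.8 (i), first display p. 190).
[cite: MochizukiEtAl2022, Prop 1.8 (i) proof p. 190] -/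
theorem finrank_mul_hStorNon_eq_sum (t : F) (h0 : t ≠ 0) (h1 : t ≠ 1) (S : Finset (FinitePlace F))
    (hS1 : ∀ w : FinitePlace F, w t ≠ 1 → w ∈ S) (hS2 : ∀ w : FinitePlace F, w (t - 1) ≠ 1 → w ∈ S) :
    (Module.finrank ℚ F : ℝ) * hStorNon t = ∑ w ∈ S, Real.log (jProd w.val t) := by
  have hd := finrank_pos'' (F := F)
  have off : ∀ w : FinitePlace F, w ∉ S → w t = 1 ∧ w (t - 1) = 1 := fun w hw =>
    ⟨by_contra fun h => hw (hS1 w h), by_contra fun h => hw (hS2 w h)⟩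
  have eA : ∑ᶠ w : FinitePlace F, Real.log (max (w t) (w t)⁻¹) =
      ∑ w ∈ S, Real.log (max (w t) (w t)⁻¹) :=
    finsum_eq_sum_of_eq_zero_off S _ fun w hw => by simp [(off w hw).1]
  have eB : ∑ᶠ w : FinitePlace F, Real.log (max (w (1 - t)) (w (1 - t))⁻¹) =
      ∑ w ∈ S, Real.log (max (w (1 - t)) (w (1 - t))⁻¹) :=
    finsum_eq_sum_of_eq_zero_off S _ fun w hw => by
      have : w (1 - t) = 1 := by rw [FinitePlace.coe_apply, w.val.map_sub, ← FinitePlace.coe_apply, (off w hw).2]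
      simp [this]
  have eC : ∑ᶠ w : FinitePlace F, Real.log (max (w (t / (t - 1))) (w (t / (t - 1)))⁻¹) =
      ∑ w ∈ S, Real.log (max (w (t / (t - 1))) (w (t / (t - 1)))⁻¹) :=
    finsum_eq_sum_of_eq_zero_off S _ fun w hw => by
      have : w (t / (t - 1)) = 1 := by rw [map_div₀, (off w hw).1, (off w hw).2, div_one]
      simp [this]
  rw [hStorNon_eq]
  unfold hTorNon
  rw [eA, eB, eC, ← mul_add, ← mul_add, ← Finset.sum_add_distrib, ← Finset.sum_add_distrib]
  rw [show (Module.finrank ℚ F : ℝ) * (2 * ((2 * (Module.finrank ℚ F : ℝ))⁻¹ *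
      ∑ w ∈ S, (Real.log (max (w t) (w t)⁻¹) + Real.log (max (w (1 - t)) (w (1 - t))⁻¹) +
        Real.log (max (w (t / (t - 1))) (w (t / (t - 1)))⁻¹)))) =
      ∑ w ∈ S, (Real.log (max (w t) (w t)⁻¹) + Real.log (max (w (1 - t)) (w (1 - t))⁻¹) +
        Real.log (max (w (t / (t - 1))) (w (t / (t - 1)))⁻¹)) by field_simp]
  refine Finset.sum_congr rfl fun w _ => ?_
  simp only [FinitePlace.coe_apply]
  exact log_toric_three_eq_log_jProd w.val t h0 h1

/-- `[F:ℚ]·h^{𝔖-tor}_arc(E) = Σ_{v ∣ ∞} [F_v:ℝ]·log(J_{0∞}(λ)_v·J_{1∞}(λ)_v·J_{01}(λ)_v)` (proof of Prop. 1.8 (ii), display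
p. 191). [cite: MochizukiEtAl2022, Prop 1.8 (ii) proof p. 191] -/
theorem finrank_mul_hStorArc_eq_sum (t : F) (h0 : t ≠ 0) (h1 : t ≠ 1) :
    (Module.finrank ℚ F : ℝ) * hStorArc t =
      ∑ w : InfinitePlace F, (w.mult : ℝ) * Real.log (jProd w.val t) := by
  have hd := finrank_pos'' (F := F)
  rw [hStorArc_eq]
  unfold hTorArc
  rw [← mul_add, ← mul_add, ← Finset.sum_add_distrib, ← Finset.sum_add_distrib]
  rw [show (Module.finrank ℚ F : ℝ) * (2 * ((2 * (Module.finrank ℚ F : ℝ))⁻¹ *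
      ∑ w : InfinitePlace F, ((w.mult : ℝ) * Real.log (max (w t) (w t)⁻¹) +
        (w.mult : ℝ) * Real.log (max (w (1 - t)) (w (1 - t))⁻¹) +
        (w.mult : ℝ) * Real.log (max (w (t / (t - 1))) (w (t / (t - 1)))⁻¹)))) =
      ∑ w : InfinitePlace F, ((w.mult : ℝ) * Real.log (max (w t) (w t)⁻¹) +
        (w.mult : ℝ) * Real.log (max (w (1 - t)) (w (1 - t))⁻¹) +
        (w.mult : ℝ) * Real.log (max (w (t / (t - 1))) (w (t / (t - 1)))⁻¹)) by field_simp]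
  refine Finset.sum_congr rfl fun w _ => ?_
  rw [← mul_add, ← mul_add]
  congr 1
  simp only [InfinitePlace.coe_apply]
  exact log_toric_three_eq_log_jProd w.1 t h0 h1

/-- **[ExpEst] Proposition 1.8 (i)**: "`0 ≤ h^{𝔖-tor}_non(E) − h_non(j(E)) ≤ 8·log 2`" (`E ≅ y² = x(x−1)(x−λ)`, `j(E) =
2^8(λ²−λ+1)³/(λ²(λ−1)²)`). Proof as printed (p. 190–191): place by place `log(J_{0∞}J_{1∞}J_{01}) = log max{J, 1}`
(Lemma 1.6 (iv)) and `|j(E)|_v = |2|_v^8·J(λ)_v`, so the difference of the local terms lies in `[0, −8·log|2|_v]`,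
and `Σ_{v ∤ ∞} −log|2|_v = [F:ℚ]·log 2`. [cite: MochizukiEtAl2022, Prop 1.8 (i) p. 190] -/
theorem hStorNon_sub_hNon_jInv_bounds (t : F) (h0 : t ≠ 0) (h1 : t ≠ 1) :
    0 ≤ hStorNon t - hNon (jInv t) ∧ hStorNon t - hNon (jInv t) ≤ 8 * Real.log 2 := by
  have hd := finrank_pos'' (F := F)
  set d : ℝ := (Module.finrank ℚ F : ℝ) with hdd
  have ht1 : t - 1 ≠ 0 := sub_ne_zero.mpr h1
  -- a finite set of places outside of which `|λ|_w = |λ−1|_w = |2|_w = 1`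
  obtain ⟨S1, hS1⟩ := exists_finset_places' h0
  obtain ⟨S2, hS2⟩ := exists_finset_places' ht1
  obtain ⟨S3, hS3⟩ := exists_finset_places' (two_ne_zero : (2 : F) ≠ 0)
  set S := S1 ∪ S2 ∪ S3 with hSdef
  have m1 : ∀ w : FinitePlace F, w t ≠ 1 → w ∈ S := fun w hw => by
    rw [hSdef, Finset.mem_union, Finset.mem_union]; exact Or.inl (Or.inl (hS1 w hw))
  have m2 : ∀ w : FinitePlace F, w (t - 1) ≠ 1 → w ∈ S := fun w hw => by
    rw [hSdef, Finset.mem_union, Finset.mem_union]; exact Or.inl (Or.inr (hS2 w hw))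
  have m3 : ∀ w : FinitePlace F, w (2 : F) ≠ 1 → w ∈ S := fun w hw => by
    rw [hSdef, Finset.mem_union]; exact Or.inr (hS3 w hw)
  have off : ∀ w : FinitePlace F, w ∉ S → w t = 1 ∧ w (t - 1) = 1 ∧ w (2 : F) = 1 := fun w hw =>
    ⟨by_contra fun h => hw (m1 w h), by_contra fun h => hw (m2 w h), by_contra fun h => hw (m3 w h)⟩
  -- local data
  have hna : ∀ w : FinitePlace F, IsNonarchimedean w.val := fun w a b => FinitePlace.add_le w a b
  have hu : ∀ w : FinitePlace F, 0 < w.val (2 : F) ∧ w.val (2 : F) ≤ 1 := by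
    intro w
    refine ⟨w.val.pos two_ne_zero, ?_⟩
    have h' := hna w 1 1
    rwa [one_add_one_eq_two, w.val.map_one, max_self] at h'
  -- (A) `d·h^{𝔖-tor}_non = Σ_S log jProd`
  have hA := finrank_mul_hStorNon_eq_sum t h0 h1 S m1 m2
  -- (B) `d·h_non(j) = Σ_S log⁺(|2|^8 J)`
  have hB : d * hNon (jInv t) = ∑ w ∈ S, log⁺ (w.val (2 : F) ^ 8 * J w.val t) := by
    unfold hNon
    rw [← hdd, ← mul_assoc, mul_inv_cancel₀ hd.ne', one_mul]
    refine (finsum_eq_sum_of_eq_zero_off S _ fun w hw => ?_).trans (Finset.sum_congr rfl fun w _ => ?_)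
    · obtain ⟨hx, hy, h2⟩ := off w hw
      rw [FinitePlace.coe_apply, apply_jInv, posLog_eq_zero_iff]
      have hx' : w.val t = 1 := hx
      have hy' : w.val (t - 1) = 1 := hy
      have h2' : w.val (2 : F) = 1 := h2
      rw [h2', one_pow, one_mul, abs_of_nonneg (J_nonneg _ _)]
      exact J_le_one_of_apply_eq_one w.val (hna w) hx' hy'
    · rw [FinitePlace.coe_apply, apply_jInv]
  -- (C) local bounds
  have hC : ∀ w ∈ S, 0 ≤ Real.log (jProd w.val t) - log⁺ (w.val (2 : F) ^ 8 * J w.val t) ∧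
      Real.log (jProd w.val t) - log⁺ (w.val (2 : F) ^ 8 * J w.val t) ≤ -(8 * Real.log (w.val (2 : F))) := by
    intro w _
    have hJ := J_nonneg w.val t
    have hu8 : 0 < w.val (2 : F) ^ 8 ∧ w.val (2 : F) ^ 8 ≤ 1 :=
      ⟨pow_pos (hu w).1 8, pow_le_one₀ (hu w).1.le (hu w).2⟩
    have h8 : Real.log (w.val (2 : F) ^ 8) = 8 * Real.log (w.val (2 : F)) := by
      rw [Real.log_pow]; norm_num
    rw [← max_J_one_eq_jProd w.val (hna w) t h0 h1,
      posLog_eq_log_max_one (mul_nonneg hu8.1.le hJ), ← h8]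
    exact log_max_sub_log_max_mul_bounds hu8.1 hu8.2 hJ
  -- (D) `Σ_S log|2|_w = −d·log 2`
  have hD : ∑ w ∈ S, Real.log (w.val (2 : F)) = -(d * Real.log 2) := by
    rw [hdd, ← finsum_log_two]
    refine (finsum_eq_sum_of_eq_zero_off S _ fun w hw => ?_).symm.trans ?_
    · have h2 : w.val (2 : F) = 1 := (off w hw).2.2
      rw [h2, Real.log_one]
    · rfl
  -- assemble
  have hdiff : d * (hStorNon t - hNon (jInv t)) =
      ∑ w ∈ S, (Real.log (jProd w.val t) - log⁺ (w.val (2 : F) ^ 8 * J w.val t)) := by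
    rw [mul_sub, hA, hB, Finset.sum_sub_distrib]
  have hlow : 0 ≤ d * (hStorNon t - hNon (jInv t)) := by
    rw [hdiff]; exact Finset.sum_nonneg fun w hw => (hC w hw).1
  have hupp : d * (hStorNon t - hNon (jInv t)) ≤ d * (8 * Real.log 2) := by
    rw [hdiff]
    calc ∑ w ∈ S, (Real.log (jProd w.val t) - log⁺ (w.val (2 : F) ^ 8 * J w.val t))
        ≤ ∑ w ∈ S, -(8 * Real.log (w.val (2 : F))) := Finset.sum_le_sum fun w hw => (hC w hw).2
      _ = -(8 * ∑ w ∈ S, Real.log (w.val (2 : F))) := by rw [Finset.mul_sum, Finset.sum_neg_distrib]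
      _ = d * (8 * Real.log 2) := by rw [hD]; ring
  constructor
  · exact (mul_nonneg_iff_of_pos_left hd).mp hlow
  · exact le_of_mul_le_mul_left hupp hd

/-- **[ExpEst] Proposition 1.8 (ii)**: "`−11·log 2 ≤ h^{𝔖-tor}_arc(E) − h_arc(j(E)) ≤ 2·log 2`". Proof as printed (p.
191): at each archimedean place Lemma 1.6 (iii) with `ε = 2` and `|j(E)|_v = 2^8·J(λ)_v` give
`log(J_{0∞}J_{1∞}J_{01}) − log max{2^8 J, 1} ∈ [−11·log 2, 2·log 2]`; average with the weights `[F_v:ℝ]/[F:ℚ]`.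
[cite: MochizukiEtAl2022, Prop 1.8 (ii) p. 190] -/
theorem hStorArc_sub_hArc_jInv_bounds (t : F) (h0 : t ≠ 0) (h1 : t ≠ 1) :
    -(11 * Real.log 2) ≤ hStorArc t - hArc (jInv t) ∧ hStorArc t - hArc (jInv t) ≤ 2 * Real.log 2 := by
  have hd := finrank_pos'' (F := F)
  set d : ℝ := (Module.finrank ℚ F : ℝ) with hdd
  have hlog2 : 0 < Real.log 2 := Real.log_pos (by norm_num)
  -- (A) `d·h^{𝔖-tor}_arc = Σ_w m_w log jProd`
  have hA := finrank_mul_hStorArc_eq_sum t h0 h1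
  -- (B) `d·h_arc(j) = Σ_w m_w log max{2^8 J, 1}`
  have hB : d * hArc (jInv t) =
      ∑ w : InfinitePlace F, (w.mult : ℝ) * Real.log (max (2 ^ 8 * J w.val t) 1) := by
    unfold hArc
    rw [← hdd, ← mul_assoc, mul_inv_cancel₀ hd.ne', one_mul]
    refine Finset.sum_congr rfl fun w _ => ?_
    congr 1
    rw [InfinitePlace.coe_apply, apply_jInv, show w.1 (2 : F) = 2 from infinitePlace_two w,
      posLog_eq_log_max_one (mul_nonneg (by norm_num) (J_nonneg _ _)), max_comm]
  -- (C) local bounds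
  have hC : ∀ w : InfinitePlace F,
      -(11 * Real.log 2) ≤ Real.log (jProd w.val t) - Real.log (max (2 ^ 8 * J w.val t) 1) ∧
        Real.log (jProd w.val t) - Real.log (max (2 ^ 8 * J w.val t) 1) ≤ 2 * Real.log 2 := by
    intro w
    have hP := jProd_pos w.val t h0 h1
    have hM : 1 ≤ max (2 ^ 8 * J w.val t) 1 := le_max_right _ _
    obtain ⟨hl, hr⟩ := jProd_le_max_and_max_le_jProd_two w.val t h0 h1
    constructor
    · have := Real.log_le_log (by linarith) hr
      rw [Real.log_mul (by norm_num) hP.ne', Real.log_pow] at this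
      simp only [Nat.cast_ofNat] at this
      linarith
    · have h4 : jProd w.val t ≤ 2 ^ 2 * max (2 ^ 8 * J w.val t) 1 := by
        rw [div_le_iff₀ (by norm_num)] at hl; linarith
      have := Real.log_le_log hP h4
      rw [Real.log_mul (by norm_num) (by linarith), Real.log_pow] at this
      simp only [Nat.cast_ofNat] at this
      linarith
  -- assemble
  have hdiff : d * (hStorArc t - hArc (jInv t)) = ∑ w : InfinitePlace F,
      (w.mult : ℝ) * (Real.log (jProd w.val t) - Real.log (max (2 ^ 8 * J w.val t) 1)) := by
    rw [mul_sub, hA, hB, ← Finset.sum_sub_distrib]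
    refine Finset.sum_congr rfl fun w _ => by ring
  have hlow : d * -(11 * Real.log 2) ≤ d * (hStorArc t - hArc (jInv t)) := by
    rw [hdiff, hdd, ← sum_mult_real, Finset.sum_mul]
    exact Finset.sum_le_sum fun w _ => mul_le_mul_of_nonneg_left (hC w).1 (Nat.cast_nonneg _)
  have hupp : d * (hStorArc t - hArc (jInv t)) ≤ d * (2 * Real.log 2) := by
    rw [hdiff, hdd, ← sum_mult_real, Finset.sum_mul]
    exact Finset.sum_le_sum fun w _ => mul_le_mul_of_nonneg_left (hC w).2 (Nat.cast_nonneg _)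
  exact ⟨le_of_mul_le_mul_left hlow hd, le_of_mul_le_mul_left hupp hd⟩

/-! ## 4. Proposition 1.9 (Comparison between `h_non(j(E))` and `h_arc(j(E))`), p. 191–192 -/

/-- **[ExpEst] Proposition 1.9 (i)**: "`h^{𝔖-tor}_arc(E) ≤ h^{𝔖-tor}_non(E)`" when the field is mono-complex ("follows
immediately from Lemma 1.3, (iii)", applied to the six elements of `𝔖₃·λ`). Hypothesis rendered as "`F` is
mono-complex" (see the module docstring). [cite: MochizukiEtAl2022, Prop 1.9 (i) p. 191] -/
theorem hStorArc_le_hStorNon (hF : IsMonoComplex F) (t : F) (h0 : t ≠ 0) (h1 : t ≠ 1) :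
    hStorArc t ≤ hStorNon t := by
  have ht1 : t - 1 ≠ 0 := sub_ne_zero.mpr h1
  have h1t : (1 : F) - t ≠ 0 := sub_ne_zero.mpr (Ne.symm h1)
  unfold hStorArc hStorNon
  have e1 := hTorArc_le_hTorNon hF t h0
  have e2 := hTorArc_le_hTorNon hF t⁻¹ (inv_ne_zero h0)
  have e3 := hTorArc_le_hTorNon hF (1 - t) h1t
  have e4 := hTorArc_le_hTorNon hF (1 - t)⁻¹ (inv_ne_zero h1t)
  have e5 := hTorArc_le_hTorNon hF (t / (t - 1)) (div_ne_zero h0 ht1)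
  have e6 := hTorArc_le_hTorNon hF ((t - 1) / t) (div_ne_zero ht1 h0)
  linarith

/-- **[ExpEst] Proposition 1.9 (ii)**: "`h_arc(j(E)) ≤ h_non(j(E)) + 19·log 2`" ("follows from assertion (i) and
Proposition 1.8, (i), (ii)": `h_arc(j) ≤ h^{𝔖-tor}_arc + 11 log 2 ≤ h^{𝔖-tor}_non + 11 log 2 ≤ h_non(j) + 19 log 2`).
[cite: MochizukiEtAl2022, Prop 1.9 (ii) p. 191] -/
theorem hArc_jInv_le (hF : IsMonoComplex F) (t : F) (h0 : t ≠ 0) (h1 : t ≠ 1) :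
    hArc (jInv t) ≤ hNon (jInv t) + 19 * Real.log 2 := by
  have h8 := hStorNon_sub_hNon_jInv_bounds t h0 h1
  have h11 := hStorArc_sub_hArc_jInv_bounds t h0 h1
  have hi := hStorArc_le_hStorNon hF t h0 h1
  linarith [h8.2, h11.1]

/-- The consequence used in the proof of Prop. 1.9 (iii) (p. 192): "`h(j(E)) = h_non(j(E)) + h_arc(j(E)) ≤
2·h_non(j(E)) + 19·log 2`". [cite: MochizukiEtAl2022, Prop 1.9 (iii) proof p. 192] -/
theorem height_jInv_le (hF : IsMonoComplex F) (t : F) (h0 : t ≠ 0) (h1 : t ≠ 1) :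
    height (jInv t) ≤ 2 * hNon (jInv t) + 19 * Real.log 2 := by
  unfold height; have := hArc_jInv_le hF t h0 h1; linarith

/-- **[ExpEst] Proposition 1.9 (iii)** (Northcott): "If `C ∈ ℝ`, then the element `j(E)` … is completely determined up
to a finite number of possibilities by the condition `h_non(−) ≤ C`" — typed for the Legendre `j`-invariants
`j(λ)`, `λ ∈ F \ {0,1}`, of a FIXED mono-complex number field `F` (Mathlib's Northcott property
`NumberField.finite_setOf_logHeight₁_le`; print's version over `Q̄` needs Northcott in bounded degree — declared
WEAKER in the module docstring). [cite: MochizukiEtAl2022, Prop 1.9 (iii) p. 191–192] -/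
theorem finite_jInv_of_hNon_le (hF : IsMonoComplex F) (C : ℝ) :
    {j : F | ∃ t : F, t ≠ 0 ∧ t ≠ 1 ∧ j = jInv t ∧ hNon j ≤ C}.Finite := by
  have hd := finrank_pos'' (F := F)
  refine (NumberField.finite_setOf_logHeight₁_le (K := F)
    ((Module.finrank ℚ F : ℝ) * (2 * C + 19 * Real.log 2))).subset ?_
  rintro j ⟨t, h0, h1, rfl, hC⟩
  have hh := height_jInv_le hF t h0 h1
  have he := height_eq_logHeight₁_div (jInv t)
  rw [eq_div_iff hd.ne'] at he
  show Height.logHeight₁ (jInv t) ≤ _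
  nlinarith

end ExpEst

end Literature.IUT.LogVolume

end
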